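import Literature.NumberTheory.EllipticCurves.HeckeOperatorsDoubleCoset
import Literature.NumberTheory.EllipticCurves.HeckeOperatorsGamma0Proofs

/-!
# Coprime multiplicativity of `[Γ₀(N) diag(1, ·) Γ₀(N)]` (trunk EllArithM, item C5)

This file **discharges the named fact
`Literature.NumberTheory.EllipticCurves.ModularForms.heckeT_mul_of_coprime`** of
`HeckeOperators.lean`:
`theorem heckeT_mul_of_coprime_holds : heckeT_mul_of_coprime N k`, i.e. for every `N ≥ 1`, every
weight `k` and all coprime `m, n ≥ 1`,
`[Γ₀(N) diag(1, mn) Γ₀(N)] = [Γ₀(N) diag(1, m) Γ₀(N)] ∘ [Γ₀(N) diag(1, n) Γ₀(N)]` on `S_k(Γ₀(N))`.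

## Source

G. Shimura, *Introduction to the arithmetic theory of automorphic functions* (1971), Ch. 3. The
identity is the instance `Γ' = Γ₀(N)` (i.e. (3.3.2) with `𝔥 = (ℤ/Nℤ)ˣ`, `t = 1`) of Shimura's
multiplication rules in the Hecke ring `R(Γ', Δ')`: Prop. 3.16 (for `Γ = SL_n(ℤ)`,
`(Γ α Γ)(Γ β Γ) = Γ αβ Γ` when `det α`, `det β` are coprime), transported to `Γ'` by Prop. 3.31–3.33
and Th. 3.34 (3), (4), and then to cusp forms by (3.4.1) and Prop. 3.38 (`f ↦ f ∣ [Γ α Γ]_k` is a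
representation of `R(Γ, Δ)`). (The docstring of the fact cites "Prop. 3.7 / (3.3.5)": Prop. 3.7 is
the special case `Γ αβ Γ' = (Γ α Γ)(Γ β Γ')` for `Γ α = α Γ`, and (3.3.5) is the condition
`a ∣ d, (d, N) = 1` under which `T'(a, d)` is defined; the result proved here is the one described
above.)

## Proof

We do not develop the Hecke ring; instead we prove directly the coset-level content of the
identity `(Γ δₙ Γ)(Γ δₘ Γ) = Γ δₙδₘ Γ` (`Γ = Γ₀(N)`, `δₘ = diag(1, m)`, `gcd(m, n) = 1`): if
`Γ δₙ Γ = ⊔ᵢ Γ αᵢ` and `Γ δₘ Γ = ⊔ⱼ Γ βⱼ` then `Γ δₙ δₘ Γ = ⊔_{i,j} Γ αᵢ βⱼ`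
(`gamma0_isDoubleCosetDecomp_mul`). Given this, the double coset formula (Shimura (3.4.1);
`coe_cuspHeckeCorrespondence_eq_sum`, `coe_cuspHeckeOperator_cuspHeckeOperator_eq_sum` of
`HeckeOperatorsDoubleCoset.lean`) identifies both sides of the fact with `∑ᵢ ∑ⱼ f ∣[k] αᵢ βⱼ`
(`heckeT_mul_eq_heckeT_mul_heckeT_of_isDoubleCosetDecomp`). The coset statement has three parts:

* `IsDoubleCosetDecomp.mul` (pure group theory, Shimura §3.1): `Γ g Γ h Γ ⊆ ⋃ Γ αᵢ βⱼ` always, so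
  the products form a decomposition of `Γ g h Γ` as soon as they lie in `Γ g h Γ` and distinct
  pairs give distinct right cosets.
* `HeckeTMul.diag_mul_mul_diag_mem_doubleCoset`: `Γ δₙ Γ δₘ Γ ⊆ Γ δₙδₘ Γ` — for
  `γ = (a b; c d) ∈ Γ₀(N)` the integer matrix `δₙ γ δₘ = (a, bm; nc, nmd)` is primitive
  (`gcd(a, b) = gcd(a, c) = 1`, `gcd(m, n) = 1`), hence `Γ₀(N)`-equivalent on both sides to
  `diag(1, nm)` by the row and column reduction of Shimura's Prop. 3.32(1) (the tree's
  `HeckeTComm.exists_gamma1_mul_mul_gamma0_eq_diagonal`).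
* `HeckeTMul.exists_gamma0_mul_eq_of_isCoprime` (the analogue of the lattice argument of Shimura's
  Prop. 3.16 for `Γ₀(N)`): if `γ A' B' = A B` with `det A = det A' = n`, `det B = det B' = m`,
  `γ ∈ Γ₀(N)` and all lower left entries divisible by `N`, then `B = γ' B'` with `γ' ∈ Γ₀(N)`:
  `Y = B adj(B')` and `Z = adj(A) γ A'` satisfy `nY = mZ`, so with `um + vn = 1` the integer matrix
  `γ' = uY + vZ` has `mγ' = Y`, whence `γ' B' = B`, `det γ' = 1`, `N ∣ γ'₁₀`.

## References

* G. Shimura, *Introduction to the arithmetic theory of automorphic functions*, Publ. Math. Soc.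
  Japan 11, Iwanami Shoten / Princeton University Press, 1971 (lit store
  `book:shimura1973-introduction-arithmetic-theory-automorphic-functions`): §3.1 (Prop. 3.1,
  (3.1.1), Prop. 3.7), §3.2 (Prop. 3.16), §3.3 (Prop. 3.31–3.33, Th. 3.34, (3.3.5), (3.3.9)),
  §3.4 ((3.4.1), Prop. 3.38).
* F. Diamond, J. Shurman, *A first course in modular forms*, GTM 228, Springer, 2005, §5.1–5.3.
-/

noncomputable section

open scoped MatrixGroups ModularForm

open ConjAct Pointwise UpperHalfPlane

namespace Literature.NumberTheory.EllipticCurves.ModularForms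

/-! ### Products of right coset decompositions (group theory) -/

section GroupTheory

variable {G : Type*} [Group G] {Γ : Subgroup G} {g h : G} {ι κ : Type*} {α : ι → G} {β : κ → G}

namespace IsDoubleCosetDecomp

/-- If `Γ g Γ = ⊔ᵢ Γ αᵢ` and `Γ h Γ = ⊔ⱼ Γ βⱼ`, then every `x ∈ Γ gh Γ` (indeed every element of
`Γ g Γ h Γ`) lies in some right coset `Γ αᵢ βⱼ` (Shimura 1971, §3.1, the discussion of (3.1.1):
`Γ α Γ β Γ = ⋃ Γ αᵢ βⱼ`). [folklore] -/
theorem exists_mul_mul_inv_mem (hα : IsDoubleCosetDecomp Γ Γ g α)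
    (hβ : IsDoubleCosetDecomp Γ Γ h β) {x : G}
    (hx : x ∈ DoubleCoset.doubleCoset (g * h) (Γ : Set G) Γ) :
    ∃ i j, x * (α i * β j)⁻¹ ∈ Γ := by
  obtain ⟨u, hu, v, hv, rfl⟩ := DoubleCoset.mem_doubleCoset.mp hx
  have hhv : h * v ∈ DoubleCoset.doubleCoset h (Γ : Set G) Γ :=
    DoubleCoset.mem_doubleCoset.mpr ⟨1, Γ.one_mem, v, hv, by rw [one_mul]⟩
  obtain ⟨j, hj⟩ := (hβ.existsUnique _ hhv).exists
  have hug : u * g * (h * v * (β j)⁻¹) ∈ DoubleCoset.doubleCoset g (Γ : Set G) Γ :=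
    DoubleCoset.mem_doubleCoset.mpr ⟨u, hu, _, hj, rfl⟩
  obtain ⟨i, hi⟩ := (hα.existsUnique _ hug).exists
  refine ⟨i, j, ?_⟩
  convert hi using 1
  group

/-- **Decomposition of a product double coset.** Let `Γ g Γ = ⊔ᵢ Γ αᵢ` and `Γ h Γ = ⊔ⱼ Γ βⱼ`.
If every product `αᵢ βⱼ` lies in `Γ gh Γ` (i.e. `Γ g Γ h Γ = Γ gh Γ`) and `Γ αᵢ βⱼ = Γ αᵢ' βⱼ'`
forces `Γ βⱼ = Γ βⱼ'`, then `Γ gh Γ = ⊔_{i,j} Γ αᵢ βⱼ`; in the Hecke ring this is the identity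
`(Γ g Γ)(Γ h Γ) = Γ gh Γ` (Shimura 1971, §3.1 (3.1.1): the multiplicity of `Γ ξ Γ` in the product
is `#{(i, j) : Γ αᵢ βⱼ = Γ ξ}`). [cite: Shimura1971, §3.1 (3.1.1)] -/
theorem mul (hα : IsDoubleCosetDecomp Γ Γ g α) (hβ : IsDoubleCosetDecomp Γ Γ h β)
    (hmem : ∀ i j, α i * β j ∈ DoubleCoset.doubleCoset (g * h) (Γ : Set G) Γ)
    (hsep : ∀ i j i' j', α i * β j * (α i' * β j')⁻¹ ∈ Γ → β j * (β j')⁻¹ ∈ Γ) :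
    IsDoubleCosetDecomp Γ Γ (g * h) (fun p : ι × κ ↦ α p.1 * β p.2) where
  mem p := hmem p.1 p.2
  existsUnique x hx := by
    obtain ⟨i, j, hij⟩ := hα.exists_mul_mul_inv_mem hβ hx
    refine ⟨(i, j), hij, ?_⟩
    rintro ⟨i', j'⟩ hij'
    dsimp only at hij' ⊢
    have h1 : α i' * β j' * (α i * β j)⁻¹ ∈ Γ := by
      have := Γ.mul_mem (Γ.inv_mem hij') hij
      convert this using 1
      group
    have hj : j' = j :=
      hβ.eq_of_mul_inv_mem (hβ.mem j') (by rw [mul_inv_cancel]; exact Γ.one_mem)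
        (hsep _ _ _ _ h1)
    subst hj
    have h3 : α i' * (α i)⁻¹ ∈ Γ := by
      convert h1 using 1
      group
    have hi : i' = i :=
      hα.eq_of_mul_inv_mem (hα.mem i') (by rw [mul_inv_cancel]; exact Γ.one_mem) h3
    subst hi
    rfl

end IsDoubleCosetDecomp

end GroupTheory

/-! ### From product decompositions to products of Hecke operators -/

section Operators

/-- `diag(1, n) diag(1, m) = diag(1, mn)` in `GL(2, ℝ)`. [folklore] -/
lemma diagOneR_mul_diagOneR (m n : ℕ) [NeZero m] [NeZero n] :
    diagOneR n * diagOneR m = diagOneR (m * n) := by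
  have h : ∀ (r : ℕ) [NeZero r],
      ((diagOneR r : GL (Fin 2) ℝ) : Matrix (Fin 2) (Fin 2) ℝ) = !![1, 0; 0, (r : ℝ)] :=
    fun r _ ↦ val_tpG r
  refine Units.ext ?_
  rw [Units.val_mul, h n, h m, h (m * n)]
  ext i j
  fin_cases i <;> fin_cases j <;> simp [Matrix.mul_apply, Fin.sum_univ_two, mul_comm]

variable (Γ : Subgroup (GL (Fin 2) ℝ)) [Γ.IsArithmetic] [Γ.HasDetOne] (k : ℤ)

/-- **`[Γ δ_q Γ][Γ δ_p Γ] = [Γ δ_{pq} Γ]` from a product decomposition.** If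
`Γ diag(1,q) Γ = ⊔ᵢ Γ αᵢ`, `Γ diag(1,p) Γ = ⊔ⱼ Γ βⱼ` and the products `αᵢ βⱼ` form a
decomposition of `Γ diag(1, pq) Γ`, then
`heckeT Γ k (p q) = heckeT Γ k p * heckeT Γ k q` on `S_k(Γ)`: both sides send `f` to
`∑ᵢ ∑ⱼ f ∣[k] αᵢ βⱼ` by the double coset formula (Shimura 1971, (3.4.1) and Prop. 3.38).
[cite: Shimura1971, (3.4.1) and Prop. 3.38] -/
theorem heckeT_mul_eq_heckeT_mul_heckeT_of_isDoubleCosetDecomp (p q : ℕ) [NeZero p] [NeZero q]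
    {ι κ : Type*} [Fintype ι] [Fintype κ] {α : ι → GL (Fin 2) ℝ} {β : κ → GL (Fin 2) ℝ}
    (hα : IsDoubleCosetDecomp Γ Γ (diagOneR q) α) (hβ : IsDoubleCosetDecomp Γ Γ (diagOneR p) β)
    (hprod : IsDoubleCosetDecomp Γ Γ (diagOneR (p * q)) (fun ij : ι × κ ↦ α ij.1 * β ij.2)) :
    heckeT Γ k (p * q) = heckeT Γ k p * heckeT Γ k q := by
  refine LinearMap.ext fun f ↦ DFunLike.ext' ?_
  change ⇑(cuspHeckeOperator Γ k _ f) =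
    ⇑(cuspHeckeOperator Γ k _ (cuspHeckeOperator Γ k _ f))
  rw [coe_cuspHeckeOperator_cuspHeckeOperator_eq_sum Γ k _ _ hα hβ f, cuspHeckeOperator,
    coe_cuspHeckeCorrespondence_eq_sum Γ Γ k _ hprod f]
  exact Fintype.sum_prod_type' fun i j ↦ (⇑f : ℍ → ℂ) ∣[k] (α i * β j)

end Operators

/-! ### Integer matrix lemmas for `Γ₀(N)` -/

namespace HeckeTMul

open Matrix CongruenceSubgroup Matrix.SpecialLinearGroup

section IntArith

/-- `N ∣ (P Q)₁₀` if `N ∣ P₁₀` and `N ∣ Q₁₀` (lower left entries). [folklore] -/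
lemma dvd_mul_apply_one_zero {N : ℤ} {P Q : Matrix (Fin 2) (Fin 2) ℤ} (hP : N ∣ P 1 0)
    (hQ : N ∣ Q 1 0) : N ∣ (P * Q) 1 0 := by
  simp only [Matrix.mul_apply, Fin.sum_univ_two]
  exact dvd_add (dvd_mul_of_dvd_left hP _) (dvd_mul_of_dvd_right hQ _)

/-- `N ∣ (adj P)₁₀ = -P₁₀` if `N ∣ P₁₀`. [folklore] -/
lemma dvd_adjugate_apply_one_zero {N : ℤ} {P : Matrix (Fin 2) (Fin 2) ℤ} (hP : N ∣ P 1 0) :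
    N ∣ P.adjugate 1 0 := by
  rw [Matrix.adjugate_fin_two]
  simpa using hP

/-- **Separation of right cosets for coprime determinants** (the `Γ₀(N)`-analogue of the lattice
argument in Shimura 1971, Prop. 3.16). Let `A, A'` have determinant `n`, `B, B'` determinant
`m ≠ 0`, `gcd(m, n) = 1`, all with lower left entry divisible by `N`, and let `γ` (lower left entry
divisible by `N`) satisfy `γ A' B' = A B`. Then `B = γ' B'` for some `γ' ∈ Γ₀(N)`. Proof: with
`Y = B adj(B')`, `Z = adj(A) γ A'` one has `nY = mZ`; if `um + vn = 1` then `γ' = uY + vZ` satisfies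
`mγ' = Y`, hence `γ' B' = B`, `det γ' = 1` and `N ∣ γ'₁₀`. [cite: Shimura1971, Prop. 3.16] -/
theorem exists_gamma0_mul_eq_of_isCoprime {N : ℕ} {m n : ℤ} (hm : m ≠ 0) (hmn : IsCoprime m n)
    {A A' B B' γ : Matrix (Fin 2) (Fin 2) ℤ} (hA : A.det = n) (hAc : (N : ℤ) ∣ A 1 0)
    (hA'c : (N : ℤ) ∣ A' 1 0) (hB : B.det = m) (hB' : B'.det = m) (hBc : (N : ℤ) ∣ B 1 0)
    (hB'c : (N : ℤ) ∣ B' 1 0) (hγc : (N : ℤ) ∣ γ 1 0) (h : γ * (A' * B') = A * B) :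
    ∃ γ' : SL(2, ℤ), γ' ∈ Gamma0 N ∧ (γ' : Matrix (Fin 2) (Fin 2) ℤ) * B' = B := by
  obtain ⟨u, v, huv⟩ := hmn
  set Y : Matrix (Fin 2) (Fin 2) ℤ := B * B'.adjugate with hY
  set Z : Matrix (Fin 2) (Fin 2) ℤ := A.adjugate * γ * A' with hZ
  -- `n Y = m Z`
  have hYZ : n • Y = m • Z := by
    calc n • Y = A.adjugate * A * Y := by
          rw [Matrix.adjugate_mul, hA, Matrix.smul_mul, Matrix.one_mul]
      _ = A.adjugate * (A * B) * B'.adjugate := by simp only [hY, Matrix.mul_assoc]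
      _ = A.adjugate * (γ * (A' * B')) * B'.adjugate := by rw [h]
      _ = Z * (B' * B'.adjugate) := by simp only [hZ, Matrix.mul_assoc]
      _ = m • Z := by rw [Matrix.mul_adjugate, hB', Matrix.mul_smul, Matrix.mul_one]
  set Y' : Matrix (Fin 2) (Fin 2) ℤ := u • Y + v • Z with hY'
  -- `m Y' = Y`
  have hmY' : m • Y' = Y := by
    ext i j
    have hij := congrFun (congrFun hYZ i) j
    simp only [Matrix.smul_apply, smul_eq_mul] at hij
    simp only [hY', Matrix.smul_apply, Matrix.add_apply, smul_eq_mul]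
    linear_combination (Y i j) * huv - v * hij
  -- `Y' B' = B`
  have hY'B' : Y' * B' = B := by
    have h1 : m • (Y' * B') = m • B := by
      rw [← Matrix.smul_mul, hmY', hY, Matrix.mul_assoc, Matrix.adjugate_mul, hB', Matrix.mul_smul,
        Matrix.mul_one]
    exact smul_right_injective _ hm h1
  -- `det Y' = 1`
  have hdet : Y'.det = 1 := by
    have h1 := congrArg Matrix.det hY'B'
    rw [Matrix.det_mul, hB', hB] at h1
    have : Y'.det * m = 1 * m := by rw [h1, one_mul]
    exact mul_right_cancel₀ hm this
  -- `N ∣ Y'₁₀`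
  have hc : (N : ℤ) ∣ Y' 1 0 := by
    have hY10 : (N : ℤ) ∣ Y 1 0 := dvd_mul_apply_one_zero hBc (dvd_adjugate_apply_one_zero hB'c)
    have hZ10 : (N : ℤ) ∣ Z 1 0 :=
      dvd_mul_apply_one_zero (dvd_mul_apply_one_zero (dvd_adjugate_apply_one_zero hAc) hγc) hA'c
    simp only [hY', Matrix.smul_apply, Matrix.add_apply, smul_eq_mul]
    exact dvd_add (dvd_mul_of_dvd_right hY10 u) (dvd_mul_of_dvd_right hZ10 v)
  refine ⟨⟨Y', hdet⟩, ?_, hY'B'⟩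
  rw [Gamma0_mem]
  exact (ZMod.intCast_zmod_eq_zero_iff_dvd _ N).mpr hc

/-- **A primitive element of `Δ₀(N)` is `Γ₀(N)`-equivalent on both sides to `diag(1, det)`**: if
`X ∈ M₂(ℤ)` has `det X ≠ 0`, `N ∣ X₁₀`, `gcd(X₀₀, N) = 1` and coprime entries, then
`X = γ diag(1, det X) δ` with `γ, δ ∈ Γ₀(N)` (Shimura 1971, Prop. 3.32(1)/3.33 for
`Γ' = Γ₀(N)`; here from the reduction `HeckeTComm.exists_gamma1_mul_mul_gamma0_eq_diagonal`,
whose `e` is the gcd of the entries, `= 1`). [cite: Shimura1971, Prop. 3.32(1)] -/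
theorem exists_eq_gamma0_mul_diag_mul_gamma0 (N : ℕ) {X : Matrix (Fin 2) (Fin 2) ℤ}
    (hX : X.det ≠ 0) (hc : (N : ℤ) ∣ X 1 0) (ha : IsCoprime (X 0 0) N)
    (hprim : ∀ f : ℤ, (∀ i j, f ∣ X i j) → IsUnit f) :
    ∃ γ δ : SL(2, ℤ), γ ∈ Gamma0 N ∧ δ ∈ Gamma0 N ∧
      X = (γ : Matrix (Fin 2) (Fin 2) ℤ) * !![1, 0; 0, X.det] * δ := by
  obtain ⟨γ, δ, e, d, hγ, hδ, he0, hXeq, hediv, -, -⟩ :=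
    HeckeTComm.exists_gamma1_mul_mul_gamma0_eq_diagonal N X hX hc ha
  obtain rfl : e = 1 :=
    Int.eq_one_of_dvd_one he0.le (isUnit_iff_dvd_one.mp (hprim e hediv))
  obtain rfl : d = X.det := by
    have h1 := congrArg Matrix.det hXeq
    rw [Matrix.det_mul, Matrix.det_mul, Matrix.SpecialLinearGroup.det_coe,
      Matrix.SpecialLinearGroup.det_coe, one_mul, mul_one, Matrix.det_fin_two_of] at h1
    linear_combination -h1
  refine ⟨γ⁻¹, δ⁻¹, Subgroup.inv_mem _ (Gamma1_in_Gamma0 N hγ), Subgroup.inv_mem _ hδ, ?_⟩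
  rw [← hXeq]
  rw [Matrix.mul_assoc, Matrix.mul_assoc, ← Matrix.SpecialLinearGroup.coe_mul, mul_inv_cancel,
    Matrix.SpecialLinearGroup.coe_one, Matrix.mul_one, ← Matrix.mul_assoc,
    ← Matrix.SpecialLinearGroup.coe_mul, inv_mul_cancel, Matrix.SpecialLinearGroup.coe_one,
    Matrix.one_mul]

/-- `diag(1, n) X diag(1, m) = (a, bm; nc, nmd)` for `X = (a b; c d)`. [folklore] -/
lemma diag_mul_mul_diag (X : Matrix (Fin 2) (Fin 2) ℤ) (m n : ℤ) :
    !![1, 0; 0, n] * X * !![1, 0; 0, m] = !![X 0 0, X 0 1 * m; n * X 1 0, n * X 1 1 * m] := by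
  ext i j
  fin_cases i <;> fin_cases j <;> simp only [Matrix.mul_apply, Fin.sum_univ_two] <;> simp

/-- For `γ = (a b; c d) ∈ Γ₀(N)` and coprime `m, n`, the entries of
`diag(1, n) γ diag(1, m) = (a, bm; nc, nmd)` are coprime: a common divisor `f` divides `a`, hence is
prime to `b` and `c` (`ad - bc = 1`), hence divides `m` and `n`. [folklore] -/
theorem isUnit_of_dvd_diag_mul_mul_diag {m n : ℤ} (hmn : IsCoprime m n) (γ : SL(2, ℤ)) (f : ℤ)
    (hf : ∀ i j, f ∣ (!![1, 0; 0, n] * (γ : Matrix (Fin 2) (Fin 2) ℤ) * !![1, 0; 0, m]) i j) :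
    IsUnit f := by
  have hdet := γ.det_coe
  rw [Matrix.det_fin_two] at hdet
  rw [diag_mul_mul_diag] at hf
  have ha : f ∣ γ 0 0 := by simpa using hf 0 0
  have hb : f ∣ γ 0 1 * m := by simpa using hf 0 1
  have hc' : f ∣ n * γ 1 0 := by simpa using hf 1 0
  have hab : IsCoprime (γ 0 0 : ℤ) (γ 0 1) := ⟨γ 1 1, -γ 1 0, by linear_combination hdet⟩
  have hac : IsCoprime (γ 0 0 : ℤ) (γ 1 0) := ⟨γ 1 1, -γ 0 1, by linear_combination hdet⟩
  obtain ⟨t, ht⟩ := ha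
  have hfb : IsCoprime f (γ 0 1) := by
    rw [ht] at hab
    exact hab.of_mul_left_left
  have hfc : IsCoprime f (γ 1 0) := by
    rw [ht] at hac
    exact hac.of_mul_left_left
  have hfm : f ∣ m := hfb.dvd_of_dvd_mul_left hb
  have hfn : f ∣ n := hfc.dvd_of_dvd_mul_right hc'
  exact hmn.isUnit_of_dvd' hfm hfn

end IntArith

/-! ### Transport to `GL(2, ℝ)` -/

section GLTransport

variable (N : ℕ)

/-- `diag(1, m) ∈ GL(2, ℝ)` is the image of the integer matrix `diag(1, m)`. [folklore] -/
lemma diagOneR_eq_intGL (m : ℕ) [NeZero m] : diagOneR m = intGL !![1, 0; 0, (m : ℤ)] :=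
  tpG_eq_intGL m

/-- `det diag(1, m) = m ≠ 0`. [folklore] -/
lemma det_diag_ne_zero (m : ℕ) [NeZero m] :
    (!![1, 0; 0, (m : ℤ)] : Matrix (Fin 2) (Fin 2) ℤ).det ≠ 0 := by
  simp [Matrix.det_fin_two_of, NeZero.ne m]

/-- `diag(1, m) ∈ Δ₀ᴺ(m)`. [folklore] -/
lemma diag_mem_delta0 (m : ℕ) :
    (!![1, 0; 0, (m : ℤ)] : Matrix (Fin 2) (Fin 2) ℤ) ∈ Delta0 N m :=
  ⟨by simp [Matrix.det_fin_two_of], by simp, by simpa using isCoprime_one_left⟩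

/-- Every element of `Γ₀(N) diag(1, m) Γ₀(N) ⊆ GL(2, ℝ)` is the image of an integer matrix of
`Δ₀ᴺ(m) = {det = m, N ∣ c, gcd(a, N) = 1}` (Shimura 1971, §3.3: `Γ' α Γ' ⊆ Δ'`). [folklore] -/
lemma exists_mem_delta0_of_mem_doubleCoset (m : ℕ) [NeZero m] {x : GL (Fin 2) ℝ}
    (hx : x ∈ DoubleCoset.doubleCoset (diagOneR m)
      ((Gamma0 N : Subgroup (GL (Fin 2) ℝ)) : Set (GL (Fin 2) ℝ))
      (Gamma0 N : Subgroup (GL (Fin 2) ℝ))) :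
    ∃ X ∈ Delta0 N m, x = intGL X := by
  obtain ⟨u, hu, v, hv, rfl⟩ := DoubleCoset.mem_doubleCoset.mp hx
  obtain ⟨γ, hγ, rfl⟩ := Subgroup.mem_map.mp hu
  obtain ⟨γ', hγ', rfl⟩ := Subgroup.mem_map.mp hv
  obtain ⟨U, hU, hUγ⟩ :=
    (exists_mem_delta0_one_iff (N := N) (· = (γ : Matrix (Fin 2) (Fin 2) ℤ))).mpr ⟨γ, hγ, rfl⟩
  obtain ⟨V, hV, hVγ⟩ :=
    (exists_mem_delta0_one_iff (N := N) (· = (γ' : Matrix (Fin 2) (Fin 2) ℤ))).mpr ⟨γ', hγ', rfl⟩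
  refine ⟨U * !![1, 0; 0, (m : ℤ)] * V,
    by simpa using mul_mem_delta0 (mul_mem_delta0 hU (diag_mem_delta0 N m)) hV, ?_⟩
  have hUdet : U.det ≠ 0 := by rw [hU.1]; exact one_ne_zero
  have hVdet : V.det ≠ 0 := by rw [hV.1]; exact one_ne_zero
  rw [intGL_mul (by rw [Matrix.det_mul]; exact mul_ne_zero hUdet (det_diag_ne_zero m)) hVdet,
    intGL_mul hUdet (det_diag_ne_zero m), ← diagOneR_eq_intGL, hUγ, hVγ, ← mapGL_eq_intGL,
    ← mapGL_eq_intGL]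

/-- **`Γ₀(N) diag(1,n) Γ₀(N) diag(1,m) Γ₀(N) = Γ₀(N) diag(1, nm) Γ₀(N)` for coprime `m, n`**: for
`γ ∈ Γ₀(N)`, `diag(1,n) γ diag(1,m) ∈ Γ₀(N) diag(1,n) diag(1,m) Γ₀(N)` (the integer matrix
`(a, bm; nc, nmd)` is primitive, so Shimura's Prop. 3.32(1) puts it in the double coset of
`diag(1, nm)`). [cite: Shimura1971, Prop. 3.32(1) and Prop. 3.16] -/
theorem diag_mul_mul_diag_mem_doubleCoset (m n : ℕ) [NeZero m] [NeZero n] (hmn : m.Coprime n)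
    {x : GL (Fin 2) ℝ} (hx : x ∈ (Gamma0 N : Subgroup (GL (Fin 2) ℝ))) :
    diagOneR n * x * diagOneR m ∈ DoubleCoset.doubleCoset (diagOneR n * diagOneR m)
      ((Gamma0 N : Subgroup (GL (Fin 2) ℝ)) : Set (GL (Fin 2) ℝ))
      (Gamma0 N : Subgroup (GL (Fin 2) ℝ)) := by
  obtain ⟨γ, hγ, rfl⟩ := Subgroup.mem_map.mp hx
  set X : Matrix (Fin 2) (Fin 2) ℤ :=
    !![1, 0; 0, (n : ℤ)] * (γ : Matrix (Fin 2) (Fin 2) ℤ) * !![1, 0; 0, (m : ℤ)] with hXdef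
  have hmn' : IsCoprime (m : ℤ) n := Nat.isCoprime_iff_coprime.mpr hmn
  have hXdet : X.det = n * m := by
    rw [hXdef, Matrix.det_mul, Matrix.det_mul, Matrix.SpecialLinearGroup.det_coe]
    simp [Matrix.det_fin_two_of, mul_comm]
  have hXdet0 : X.det ≠ 0 := by
    rw [hXdet]
    exact mul_ne_zero (by exact_mod_cast NeZero.ne n) (by exact_mod_cast NeZero.ne m)
  have hX' : X = !![γ 0 0, γ 0 1 * m; n * γ 1 0, n * γ 1 1 * m] := by
    rw [hXdef, diag_mul_mul_diag]
  -- `γ ∈ Δ₀(N)`: lower left entry divisible by `N`, upper left entry prime to `N`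
  obtain ⟨U, hU, hUγ⟩ :=
    (exists_mem_delta0_one_iff (N := N) (· = (γ : Matrix (Fin 2) (Fin 2) ℤ))).mpr ⟨γ, hγ, rfl⟩
  have hc : (N : ℤ) ∣ X 1 0 := by
    rw [hX']
    simpa using dvd_mul_of_dvd_right (hUγ ▸ hU.2.1) (n : ℤ)
  have ha : IsCoprime (X 0 0) N := by
    rw [hX']
    simpa using (hUγ ▸ hU.2.2)
  obtain ⟨γ₁, δ₁, hγ₁, hδ₁, hXeq⟩ := exists_eq_gamma0_mul_diag_mul_gamma0 N hXdet0 hc ha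
    (fun f hf ↦ isUnit_of_dvd_diag_mul_mul_diag hmn' γ f (by simpa only [hXdef] using hf))
  rw [hXdet] at hXeq
  -- the integer matrix `diag(1, nm) = diag(1,n) diag(1,m)`
  have hD : (!![1, 0; 0, (n : ℤ) * m] : Matrix (Fin 2) (Fin 2) ℤ) =
      !![1, 0; 0, (n : ℤ)] * !![1, 0; 0, (m : ℤ)] := by
    ext i j
    fin_cases i <;> fin_cases j <;> simp [Matrix.mul_apply, Fin.sum_univ_two]
  have hDdet : (!![1, 0; 0, (n : ℤ) * m] : Matrix (Fin 2) (Fin 2) ℤ).det ≠ 0 := by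
    rw [hD, Matrix.det_mul]
    exact mul_ne_zero (det_diag_ne_zero n) (det_diag_ne_zero m)
  refine DoubleCoset.mem_doubleCoset.mpr
    ⟨mapGL ℝ γ₁, ⟨γ₁, hγ₁, rfl⟩, mapGL ℝ δ₁, ⟨δ₁, hδ₁, rfl⟩, ?_⟩
  -- the identity in `GL(2, ℝ)`
  have hγdet : ((γ : Matrix (Fin 2) (Fin 2) ℤ)).det ≠ 0 := by
    rw [Matrix.SpecialLinearGroup.det_coe]; exact one_ne_zero
  have hγ₁det : ((γ₁ : Matrix (Fin 2) (Fin 2) ℤ)).det ≠ 0 := by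
    rw [Matrix.SpecialLinearGroup.det_coe]; exact one_ne_zero
  have hδ₁det : ((δ₁ : Matrix (Fin 2) (Fin 2) ℤ)).det ≠ 0 := by
    rw [Matrix.SpecialLinearGroup.det_coe]; exact one_ne_zero
  calc diagOneR n * mapGL ℝ γ * diagOneR m = intGL X := by
        rw [hXdef, intGL_mul (by rw [Matrix.det_mul]; exact mul_ne_zero (det_diag_ne_zero n) hγdet)
          (det_diag_ne_zero m), intGL_mul (det_diag_ne_zero n) hγdet, ← diagOneR_eq_intGL,
          ← diagOneR_eq_intGL, mapGL_eq_intGL]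
    _ = mapGL ℝ γ₁ * (diagOneR n * diagOneR m) * mapGL ℝ δ₁ := by
        rw [hXeq, intGL_mul (by rw [Matrix.det_mul]; exact mul_ne_zero hγ₁det hDdet) hδ₁det,
          intGL_mul hγ₁det hDdet, hD, intGL_mul (det_diag_ne_zero n) (det_diag_ne_zero m),
          ← diagOneR_eq_intGL, ← diagOneR_eq_intGL, mapGL_eq_intGL, mapGL_eq_intGL]

/-- **Distinct pairs give distinct cosets**: if `a, a' ∈ Γ₀(N) diag(1,n) Γ₀(N)`,
`b, b' ∈ Γ₀(N) diag(1,m) Γ₀(N)` with `gcd(m, n) = 1` and `Γ₀(N) a b = Γ₀(N) a' b'`, then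
`Γ₀(N) b = Γ₀(N) b'` (from `exists_gamma0_mul_eq_of_isCoprime`; Shimura 1971, Prop. 3.16).
[cite: Shimura1971, Prop. 3.16] -/
theorem mul_inv_mem_gamma0_of_mul_mul_inv_mem (m n : ℕ) [NeZero m] [NeZero n] (hmn : m.Coprime n)
    {a a' b b' : GL (Fin 2) ℝ}
    (ha : a ∈ DoubleCoset.doubleCoset (diagOneR n)
      ((Gamma0 N : Subgroup (GL (Fin 2) ℝ)) : Set (GL (Fin 2) ℝ))
      (Gamma0 N : Subgroup (GL (Fin 2) ℝ)))
    (ha' : a' ∈ DoubleCoset.doubleCoset (diagOneR n)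
      ((Gamma0 N : Subgroup (GL (Fin 2) ℝ)) : Set (GL (Fin 2) ℝ))
      (Gamma0 N : Subgroup (GL (Fin 2) ℝ)))
    (hb : b ∈ DoubleCoset.doubleCoset (diagOneR m)
      ((Gamma0 N : Subgroup (GL (Fin 2) ℝ)) : Set (GL (Fin 2) ℝ))
      (Gamma0 N : Subgroup (GL (Fin 2) ℝ)))
    (hb' : b' ∈ DoubleCoset.doubleCoset (diagOneR m)
      ((Gamma0 N : Subgroup (GL (Fin 2) ℝ)) : Set (GL (Fin 2) ℝ))
      (Gamma0 N : Subgroup (GL (Fin 2) ℝ)))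
    (h : a * b * (a' * b')⁻¹ ∈ (Gamma0 N : Subgroup (GL (Fin 2) ℝ))) :
    b * b'⁻¹ ∈ (Gamma0 N : Subgroup (GL (Fin 2) ℝ)) := by
  obtain ⟨A, hA, rfl⟩ := exists_mem_delta0_of_mem_doubleCoset N n ha
  obtain ⟨A', hA', rfl⟩ := exists_mem_delta0_of_mem_doubleCoset N n ha'
  obtain ⟨B, hB, rfl⟩ := exists_mem_delta0_of_mem_doubleCoset N m hb
  obtain ⟨B', hB', rfl⟩ := exists_mem_delta0_of_mem_doubleCoset N m hb'
  have hm0 : (m : ℤ) ≠ 0 := by exact_mod_cast NeZero.ne m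
  have hn0 : (n : ℤ) ≠ 0 := by exact_mod_cast NeZero.ne n
  have hAdet : A.det ≠ 0 := by rw [hA.1]; exact hn0
  have hA'det : A'.det ≠ 0 := by rw [hA'.1]; exact hn0
  have hBdet : B.det ≠ 0 := by rw [hB.1]; exact hm0
  have hB'det : B'.det ≠ 0 := by rw [hB'.1]; exact hm0
  have hABdet : (A * B).det ≠ 0 := by rw [Matrix.det_mul]; exact mul_ne_zero hAdet hBdet
  have hA'B'det : (A' * B').det ≠ 0 := by rw [Matrix.det_mul]; exact mul_ne_zero hA'det hB'det
  rw [← intGL_mul hAdet hBdet, ← intGL_mul hA'det hB'det,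
    intGL_mul_inv_mem_gamma0_iff hABdet hA'B'det] at h
  obtain ⟨γ, hγ, hγeq⟩ := h
  rw [intGL_mul_inv_mem_gamma0_iff hBdet hB'det]
  have hγc : (N : ℤ) ∣ (γ : Matrix (Fin 2) (Fin 2) ℤ) 1 0 := by
    simpa [Gamma0_mem, ZMod.intCast_zmod_eq_zero_iff_dvd] using hγ
  exact exists_gamma0_mul_eq_of_isCoprime hm0 (Nat.isCoprime_iff_coprime.mpr hmn) hA.1 hA.2.1
    hA'.2.1 hB.1 hB'.1 hB.2.1 hB'.2.1 hγc hγeq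

end GLTransport

end HeckeTMul

/-! ### The discharge -/

section Discharge

open CongruenceSubgroup

/-- **`Γ₀(N) diag(1, mn) Γ₀(N) = ⊔_{i,j} Γ₀(N) αᵢ βⱼ`** for coprime `m, n`, whenever
`Γ₀(N) diag(1,n) Γ₀(N) = ⊔ᵢ Γ₀(N) αᵢ` and `Γ₀(N) diag(1,m) Γ₀(N) = ⊔ⱼ Γ₀(N) βⱼ`: the coset-level
content of `(Γ' δₙ Γ')(Γ' δₘ Γ') = Γ' δₙδₘ Γ'` in `R(Γ₀(N), Δ')` (Shimura 1971, Prop. 3.16 with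
Prop. 3.31–3.33 and Th. 3.34 (3), (4)). [cite: Shimura1971, Prop. 3.16 and Th. 3.34] -/
theorem gamma0_isDoubleCosetDecomp_mul (N : ℕ) (m n : ℕ) [NeZero m] [NeZero n]
    (hmn : m.Coprime n) {ι κ : Type*} {α : ι → GL (Fin 2) ℝ} {β : κ → GL (Fin 2) ℝ}
    (hα : IsDoubleCosetDecomp (Gamma0 N : Subgroup (GL (Fin 2) ℝ)) (Gamma0 N) (diagOneR n) α)
    (hβ : IsDoubleCosetDecomp (Gamma0 N : Subgroup (GL (Fin 2) ℝ)) (Gamma0 N) (diagOneR m) β) :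
    IsDoubleCosetDecomp (Gamma0 N : Subgroup (GL (Fin 2) ℝ)) (Gamma0 N) (diagOneR (m * n))
      (fun ij : ι × κ ↦ α ij.1 * β ij.2) := by
  rw [← diagOneR_mul_diagOneR m n]
  refine hα.mul hβ (fun i j ↦ ?_) (fun i j i' j' hij ↦ ?_)
  · obtain ⟨u, hu, v, hv, hαi⟩ := DoubleCoset.mem_doubleCoset.mp (hα.mem i)
    obtain ⟨u', hu', v', hv', hβj⟩ := DoubleCoset.mem_doubleCoset.mp (hβ.mem j)
    have key := HeckeTMul.diag_mul_mul_diag_mem_doubleCoset N m n hmn (Subgroup.mul_mem _ hv hu')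
    have := IsDoubleCosetDecomp.mul_mem_doubleCoset
      (IsDoubleCosetDecomp.mem_doubleCoset_mul hu key) hv'
    rw [hαi, hβj]
    convert this using 1
    simp only [mul_assoc]
  · exact HeckeTMul.mul_inv_mem_gamma0_of_mul_mul_inv_mem N m n hmn (hα.mem i) (hα.mem i')
      (hβ.mem j) (hβ.mem j') hij

variable (N : ℕ) [NeZero N] (k : ℤ)

/-- **Discharge of the named fact `heckeT_mul_of_coprime`**: on `S_k(Γ₀(N))`,
`[Γ₀(N) diag(1, mn) Γ₀(N)] = [Γ₀(N) diag(1, m) Γ₀(N)] [Γ₀(N) diag(1, n) Γ₀(N)]` for coprime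
`m, n ≥ 1` — Shimura 1971, Ch. 3: the identity `(Γ' δₘ Γ')(Γ' δₙ Γ') = Γ' δₘₙ Γ'` in the Hecke ring
`R(Γ', Δ')`, `Γ' = Γ₀(N)` (Prop. 3.16 for `SL₂(ℤ)` and coprime determinants, transported to `Γ'` by
Prop. 3.31–3.33, Th. 3.34 (3), (4)), acting on cusp forms through (3.4.1) and Prop. 3.38. Here:
`gamma0_isDoubleCosetDecomp_mul` and the double coset formula.
[cite: Shimura1971, Prop. 3.16, Th. 3.34 and Prop. 3.38] -/
theorem heckeT_mul_of_coprime_holds : heckeT_mul_of_coprime N k := by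
  intro m n _ _ hmn
  obtain ⟨a, α, hα⟩ := exists_isDoubleCosetDecomp (Gamma0 N : Subgroup (GL (Fin 2) ℝ)) (Gamma0 N)
    (diagOneR n)
  obtain ⟨b, β, hβ⟩ := exists_isDoubleCosetDecomp (Gamma0 N : Subgroup (GL (Fin 2) ℝ)) (Gamma0 N)
    (diagOneR m)
  exact heckeT_mul_eq_heckeT_mul_heckeT_of_isDoubleCosetDecomp _ k m n hα hβ
    (gamma0_isDoubleCosetDecomp_mul N m n hmn hα hβ)

end Discharge

end Literature.NumberTheory.EllipticCurves.ModularForms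

end
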